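import Mathlib.LinearAlgebra.TensorProduct.Quotient
import Literature.AlgebraicGeometry.Motives.MixedHodgeStructureTensor
import Literature.AlgebraicGeometry.Motives.HodgeStructureTensorPolarization
import Literature.AlgebraicGeometry.Motives.HodgeStructureLifting
import Literature.AlgebraicGeometry.Motives.WeilTypePolarization
import Literature.AlgebraicGeometry.Motives.HodgeTensorFactsHolds
import HarnessLib

/-!
# The graded pieces of a tensor product of mixed Hodge structures:
# `Gr^W_i H₁ ⊗ Gr^W_j H₂ → Gr^W_{i+j}(H₁ ⊗ H₂)`, and `H₁ ⊗ H₂` is graded-polarizable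

For mixed `ℚ`-Hodge structures `H₁`, `H₂` on finite-dimensional `V`, `V'`, the tensor product
`H₁ ⊗ H₂` (`MixedHodgeStructure.tensor`, `Motives/MixedHodgeStructureTensor.lean`; Cattani–El
Zein–Griffiths–Lê §3.2.2.7 (1): `W_n(H ⊗ H') = Σ_{i+j=n} W_i ⊗ W_j`,
`F^p(H ⊗ H') = Σ_{a+c=p} F^a ⊗ F^c`) comes with the evident maps
`Gr^W_i H₁ ⊗ Gr^W_j H₂ → Gr^W_{i+j}(H₁ ⊗ H₂)`, `[x] ⊗ [y] ↦ [x ⊗ y]` — Deligne, *Théorie de Hodge II*,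
1.1.12 (p. 9): «on dispose de morphismes évidents `⊗ Gr(A_i) → Gr(⊗ A_i)` … Pour `H` exact, ce sont
des isomorphismes».  This file constructs these maps, proves that they are morphisms of the pure
Hodge structures `Gr^W_i H₁ ⊗ Gr^W_j H₂` (`HodgeStructure.tensor` of the `MixedHodgeStructure.gr`,
weight `i + j`) `→ Gr^W_{i+j}(H₁ ⊗ H₂)` (`MixedHodgeStructure.gr` of the tensor MHS), that for
fixed `n` they are jointly surjective — `Gr^W_n(H₁ ⊗ H₂) = Σ_{i+j=n} im(Gr^W_i H₁ ⊗ Gr^W_j H₂)` — and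
jointly injective (a retraction is built from linear extensions `V → Gr^W_k` of the projections
`W_k → Gr^W_k`), so that the morphism `⊕_{i+j=n} Gr^W_i H₁ ⊗ Gr^W_j H₂ → Gr^W_n(H₁ ⊗ H₂)` from the
(finite) direct sum is a bijective morphism of Hodge structures of weight `n` — Deligne's isomorphism
`⊕_{i+j=n} Gr^W_i H₁ ⊗ Gr^W_j H₂ ≅ Gr^W_n(H₁ ⊗ H₂)`.  Since polarizable Hodge
structures are closed under tensor products and finite direct sums (Moonen, *Families of motives
and the Mumford–Tate conjecture*, §2.1: `HS^pol_ℚ` "is closed under direct sums, tensor products and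
duality"; the tree's `IsPolarizable.tensor`, `IsPolarizable.pi`) and under quotients (Deligne,
Hodge II, 2.1.15 ff.; a surjection from a polarizable structure splits,
`HodgeStructure.Hom.exists_section_of_surjective`), **the tensor product of graded-polarizable mixed
Hodge structures is graded-polarizable** (graded-polarizable: every `Gr^W_k` is polarizable —
Carlson 1980, §2(a); the tree's `MixedHodgeStructure.IsGradedPolarizable`).

## Main results (definitions with bodies and theorems; no named facts)

* `map₂_W_le_tensor_W` — `W_i H₁ ⊗ W_j H₂ ⊆ W_{i+j}(H₁ ⊗ H₂)`; `tensorWIncl` — the induced map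
  `W_i ⊗ W_j → W_{i+j}(H₁ ⊗ H₂)`.
* **`MixedHodgeStructure.tensorGrMap H₁ H₂ n i j (h : i + j = n)`** — the canonical `ℚ`-linear map
  `Gr^W_i H₁ ⊗ Gr^W_j H₂ → Gr^W_n(H₁ ⊗ H₂)`, `[x] ⊗ [y] ↦ [x ⊗ y]` (`tensorGrMap_mk_tmul_mk`).
* **`iSup_range_tensorGrMap_eq_top`** — joint surjectivity:
  `Gr^W_n(H₁ ⊗ H₂) = Σ_i im(Gr^W_i H₁ ⊗ Gr^W_{n-i} H₂)`, the sum over any interval `[a, b]` of first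
  indices with `W_{a-1} H₁ = 0`, `W_b H₁ = V`.
* **`MixedHodgeStructure.tensorGrHom H₁ H₂ n i j h`** — `tensorGrMap` is a morphism of Hodge
  structures `Gr^W_i H₁ ⊗ Gr^W_j H₂ → Gr^W_n(H₁ ⊗ H₂)` (weight `i + j` transported to `n`).
* `tensorGrSummand`, **`tensorGrPiHom H₁ H₂ n s`** — the morphism
  `⊕_{i ∈ s} Gr^W_i H₁ ⊗ Gr^W_{n-i} H₂ → Gr^W_n(H₁ ⊗ H₂)` from the finite direct sum
  (`HodgeStructure.pi`, `Hom.piDesc`); `range_tensorGrPiHom_eq_top` (onto once `[a, b] ⊆ s`),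
  **`tensorGrPiHom_injective`** (injective for every `s`), **`tensorGrPiHom_bijective`** —
  **`⊕_{a ≤ i ≤ b} Gr^W_i H₁ ⊗ Gr^W_{n-i} H₂ ≅ Gr^W_n(H₁ ⊗ H₂)`** as Hodge structures (Deligne 1.1.12:
  «ce sont des isomorphismes»); `tensorGrMap_injective`.
* **`isPolarizable_gr_tensor`**, **`IsGradedPolarizable.tensor`** — `Gr^W_n(H₁ ⊗ H₂)` is polarizable
  for all `n` when `H₁`, `H₂` are graded-polarizable (one universe, as for the tree's
  `HodgeStructure.IsPolarizable.tensor`).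

## References

* [DeligneHodgeII1971] P. Deligne, Théorie de Hodge II, Publ. Math. IHÉS 40 (1971), 1.1.12 (p. 9),
  2.1.15, Thm. 2.3.5.
* [CattaniElZeinGriffithsLe2014] E. Cattani, F. El Zein, P. A. Griffiths, Lê D. T. (eds.), *Hodge
  Theory*, Math. Notes 49 (2014), §3.2.2.7 (1) (p. 163), Def. 3.2.15.
* [Moonen2017FamiliesMotives] B. Moonen, Families of motives and the Mumford–Tate conjecture, Milan
  J. Math. 85 (2017), §2.1 (p. 3).
* [Carlson1980] J. A. Carlson, Extensions of mixed Hodge structures (1980), §2(a).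
* [VoisinHodgeI2002] C. Voisin, *Hodge Theory and Complex Algebraic Geometry I*, §7.3.1 Lemma 7.26.
-/

noncomputable section

open scoped TensorProduct

namespace Literature.AlgebraicGeometry.Motives

namespace MixedHodgeStructure

universe u v

variable {V : Type u} [AddCommGroup V] [Module ℚ V]
variable {V' : Type v} [AddCommGroup V'] [Module ℚ V']

open Module
open HodgeStructure (tensorBaseChange tensorBaseChange_tmul)

/-! ### Linear algebra: `tensorBaseChange⁻¹` on pure tensors -/

/-- `tensorBaseChange⁻¹ ((c ⊗ a) ⊗ (d ⊗ b)) = (c d) ⊗ (a ⊗ b)`. [folklore] -/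
private theorem tensorBaseChange_symm_tmul_tmul {A : Type*} [AddCommGroup A] [Module ℚ A]
    {B : Type*} [AddCommGroup B] [Module ℚ B] (c d : ℂ) (a : A) (b : B) :
    (tensorBaseChange A B).symm ((c ⊗ₜ[ℚ] a) ⊗ₜ[ℂ] (d ⊗ₜ[ℚ] b)) = (c * d) ⊗ₜ[ℚ] (a ⊗ₜ[ℚ] b) := by
  rw [LinearEquiv.symm_apply_eq, tensorBaseChange_tmul,
    show (d ⊗ₜ[ℚ] b : ℂ ⊗[ℚ] B) = d • ((1 : ℂ) ⊗ₜ[ℚ] b) by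
      rw [TensorProduct.smul_tmul', smul_eq_mul, mul_one],
    TensorProduct.tmul_smul, TensorProduct.smul_tmul', TensorProduct.smul_tmul', smul_eq_mul, mul_comm]

variable (H₁ : MixedHodgeStructure V) (H₂ : MixedHodgeStructure V')

/-! ### The canonical maps `Gr^W_i H₁ ⊗ Gr^W_j H₂ → Gr^W_{i+j}(H₁ ⊗ H₂)` -/

section Linear

variable [FiniteDimensional ℚ V] [FiniteDimensional ℚ V']

/-- `W_i H₁ ⊗ W_j H₂ ⊆ W_n(H₁ ⊗ H₂)` for `i + j = n` (`W_n(H₁ ⊗ H₂) = Σ_{i+j=n} W_i ⊗ W_j`).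
[cite: CattaniElZeinGriffithsLe2014, §3.2.2.7] -/
theorem map₂_W_le_tensor_W {n i j : ℤ} (h : i + j = n) :
    Submodule.map₂ (TensorProduct.mk ℚ V V') (H₁.W i) (H₂.W j) ≤ (tensor H₁ H₂).W n := by
  rw [tensor_W]
  exact le_biSup (fun ij : ℤ × ℤ => Submodule.map₂ (TensorProduct.mk ℚ V V') (H₁.W ij.1) (H₂.W ij.2))
    (i := (i, j)) h

/-- The map `W_i H₁ ⊗ W_j H₂ → W_n(H₁ ⊗ H₂)`, `x ⊗ y ↦ x ⊗ y` (`i + j = n`).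
[cite: CattaniElZeinGriffithsLe2014, §3.2.2.7] -/
def tensorWIncl (n i j : ℤ) (h : i + j = n) :
    ↥(H₁.W i) ⊗[ℚ] ↥(H₂.W j) →ₗ[ℚ] ↥((tensor H₁ H₂).W n) :=
  LinearMap.codRestrict ((tensor H₁ H₂).W n) (TensorProduct.mapIncl (H₁.W i) (H₂.W j)) fun z =>
    map₂_W_le_tensor_W H₁ H₂ h
      (by rw [← TensorProduct.range_mapIncl]; exact LinearMap.mem_range_self _ z)

/-- `tensorWIncl (x ⊗ y) = x ⊗ y` in `V ⊗ V'`. [cite: CattaniElZeinGriffithsLe2014, §3.2.2.7] -/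
@[simp]
theorem coe_tensorWIncl_tmul {n i j : ℤ} (h : i + j = n) (x : H₁.W i) (y : H₂.W j) :
    (tensorWIncl H₁ H₂ n i j h (x ⊗ₜ[ℚ] y) : V ⊗[ℚ] V') = (x : V) ⊗ₜ[ℚ] (y : V') :=
  rfl

/-- `W_{i-1} H₁ ⊗ W_j H₂` and `W_i H₁ ⊗ W_{j-1} H₂` land in `W_{n-1}(H₁ ⊗ H₂)`: the relations
defining `Gr^W_i H₁ ⊗ Gr^W_j H₂` as a quotient of `W_i ⊗ W_j` die in `Gr^W_n(H₁ ⊗ H₂)`.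
[cite: DeligneHodgeII1971, 1.1.12] -/
theorem range_sup_range_le_ker_mkQ_comp_tensorWIncl {n i j : ℤ} (h : i + j = n) :
    LinearMap.range (TensorProduct.map (subPiece H₁.W i).subtype LinearMap.id) ⊔
        LinearMap.range (TensorProduct.map LinearMap.id (subPiece H₂.W j).subtype) ≤
      LinearMap.ker ((subPiece (tensor H₁ H₂).W n).mkQ ∘ₗ tensorWIncl H₁ H₂ n i j h) := by
  rw [LinearMap.ker_comp, Submodule.ker_mkQ, sup_le_iff]
  constructor
  · rintro _ ⟨z, rfl⟩
    rw [Submodule.mem_comap]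
    induction z using TensorProduct.induction_on with
    | zero => rw [map_zero, map_zero]; exact zero_mem _
    | add z w hz hw => rw [map_add, map_add]; exact add_mem hz hw
    | tmul x y =>
      rw [TensorProduct.map_tmul, Submodule.subtype_apply, LinearMap.id_apply]
      change ((tensorWIncl H₁ H₂ n i j h ((x : H₁.W i) ⊗ₜ[ℚ] y) : ↥((tensor H₁ H₂).W n)) : V ⊗[ℚ] V') ∈
        (tensor H₁ H₂).W (n - 1)
      rw [coe_tensorWIncl_tmul]
      exact map₂_W_le_tensor_W H₁ H₂ (show (i - 1) + j = n - 1 by omega)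
        (Submodule.apply_mem_map₂ _ x.2 y.2)
  · rintro _ ⟨z, rfl⟩
    rw [Submodule.mem_comap]
    induction z using TensorProduct.induction_on with
    | zero => rw [map_zero, map_zero]; exact zero_mem _
    | add z w hz hw => rw [map_add, map_add]; exact add_mem hz hw
    | tmul x y =>
      rw [TensorProduct.map_tmul, Submodule.subtype_apply, LinearMap.id_apply]
      change ((tensorWIncl H₁ H₂ n i j h (x ⊗ₜ[ℚ] (y : H₂.W j)) : ↥((tensor H₁ H₂).W n)) : V ⊗[ℚ] V') ∈
        (tensor H₁ H₂).W (n - 1)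
      rw [coe_tensorWIncl_tmul]
      exact map₂_W_le_tensor_W H₁ H₂ (show i + (j - 1) = n - 1 by omega)
        (Submodule.apply_mem_map₂ _ x.2 y.2)

/-- **The canonical map `Gr^W_i H₁ ⊗ Gr^W_j H₂ → Gr^W_n(H₁ ⊗ H₂)`** (`i + j = n`),
`[x] ⊗ [y] ↦ [x ⊗ y]`: well defined since `W_{i-1} ⊗ W_j + W_i ⊗ W_{j-1} ⊆ W_{n-1}(H₁ ⊗ H₂)`
(through Mathlib's `(M/m) ⊗ (N/n) ≃ (M ⊗ N)/(m ⊗ N + M ⊗ n)`).  Deligne, Hodge II, 1.1.12: the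
«morphismes évidents `⊗ Gr(A_i) → Gr(⊗ A_i)`». [cite: DeligneHodgeII1971, 1.1.12] -/
def tensorGrMap (n i j : ℤ) (h : i + j = n) :
    grW H₁.W i ⊗[ℚ] grW H₂.W j →ₗ[ℚ] grW (tensor H₁ H₂).W n :=
  (LinearMap.range (TensorProduct.map (subPiece H₁.W i).subtype LinearMap.id) ⊔
        LinearMap.range (TensorProduct.map LinearMap.id (subPiece H₂.W j).subtype)).liftQ
      ((subPiece (tensor H₁ H₂).W n).mkQ ∘ₗ tensorWIncl H₁ H₂ n i j h)
      (range_sup_range_le_ker_mkQ_comp_tensorWIncl H₁ H₂ h) ∘ₗ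
    (TensorProduct.quotientTensorQuotientEquiv (subPiece H₁.W i) (subPiece H₂.W j)).toLinearMap

/-- `tensorGrMap ([x] ⊗ [y]) = [x ⊗ y]`. [cite: DeligneHodgeII1971, 1.1.12] -/
@[simp]
theorem tensorGrMap_mk_tmul_mk {n i j : ℤ} (h : i + j = n) (x : H₁.W i) (y : H₂.W j) :
    tensorGrMap H₁ H₂ n i j h (Submodule.Quotient.mk x ⊗ₜ[ℚ] Submodule.Quotient.mk y) =
      Submodule.Quotient.mk (tensorWIncl H₁ H₂ n i j h (x ⊗ₜ[ℚ] y)) := by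
  rw [tensorGrMap, LinearMap.comp_apply, LinearEquiv.coe_coe,
    TensorProduct.quotientTensorQuotientEquiv_apply_tmul_mk_tmul_mk, Submodule.liftQ_apply,
    LinearMap.comp_apply, Submodule.mkQ_apply]

/-- If a subspace of `Gr^W_n(H₁ ⊗ H₂)` contains all the classes `[x ⊗ y]`, `x ∈ W_i H₁`, `y ∈ W_j H₂`,
`i + j = n`, it is everything (`W_n(H₁ ⊗ H₂)` is spanned by such `x ⊗ y`). [folklore] -/
private theorem eq_top_of_forall_mk_tensorWIncl_mem {n : ℤ} (T : Submodule ℚ (grW (tensor H₁ H₂).W n))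
    (hT : ∀ (i j : ℤ) (h : i + j = n) (x : H₁.W i) (y : H₂.W j),
      Submodule.Quotient.mk (tensorWIncl H₁ H₂ n i j h (x ⊗ₜ[ℚ] y)) ∈ T) :
    T = ⊤ := by
  have hle : (tensor H₁ H₂).W n ≤
      (T.comap (subPiece (tensor H₁ H₂).W n).mkQ).map ((tensor H₁ H₂).W n).subtype := by
    intro w hw
    rw [tensor_W] at hw
    revert hw w
    refine iSup₂_le fun ij hij => Submodule.map₂_le.2 fun x hx y hy => ?_
    exact ⟨tensorWIncl H₁ H₂ n ij.1 ij.2 hij (⟨x, hx⟩ ⊗ₜ[ℚ] ⟨y, hy⟩), hT _ _ hij ⟨x, hx⟩ ⟨y, hy⟩, rfl⟩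
  rw [eq_top_iff]
  rintro z -
  induction z using Submodule.Quotient.induction_on with
  | _ w =>
    obtain ⟨w', hw', hww'⟩ := hle w.2
    rw [Subtype.ext hww'] at hw'
    exact hw'

/-- **Joint surjectivity of the maps `Gr^W_i H₁ ⊗ Gr^W_{n-i} H₂ → Gr^W_n(H₁ ⊗ H₂)`**:
`Gr^W_n(H₁ ⊗ H₂) = Σ_{a ≤ i ≤ b} im(Gr^W_i H₁ ⊗ Gr^W_{n-i} H₂)` whenever `W_{a-1} H₁ = 0` and
`W_b H₁ = V` (a generator `x ⊗ y`, `x ∈ W_i`, `y ∈ W_{n-i}`, vanishes for `i < a` and lies in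
`W_b ⊗ W_{n-b}` for `i > b`) — the surjectivity half of Deligne's «ce sont des isomorphismes».
[cite: DeligneHodgeII1971, 1.1.12] -/
theorem iSup_range_tensorGrMap_eq_top (n : ℤ) {a b : ℤ} (ha : H₁.W (a - 1) = ⊥) (hb : H₁.W b = ⊤) :
    ⨆ i ∈ Finset.Icc a b, LinearMap.range (tensorGrMap H₁ H₂ n i (n - i) (by omega)) = ⊤ := by
  refine eq_top_of_forall_mk_tensorWIncl_mem H₁ H₂ _ fun i j h x y => ?_
  by_cases hx0 : x = 0
  · rw [hx0, TensorProduct.zero_tmul, map_zero, Submodule.Quotient.mk_zero]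
    exact zero_mem _
  -- `x ≠ 0`, so `x ∉ W_{a-1} = 0`: this forces `a ≤ i` and `a ≤ b`
  have hxa : (x : V) ∉ H₁.W (a - 1) := fun hx => hx0 (Subtype.ext (by rwa [ha, Submodule.mem_bot] at hx))
  have hia : a ≤ i := by
    by_contra hlt
    exact hxa (H₁.monotone_W (show i ≤ a - 1 by omega) x.2)
  have hab : a ≤ b := by
    by_contra hlt
    exact hxa (H₁.monotone_W (show b ≤ a - 1 by omega) (by rw [hb]; exact Submodule.mem_top))
  by_cases hib : b < i
  · -- move the generator to the index `b`
    have hxb : (x : V) ∈ H₁.W b := by rw [hb]; exact Submodule.mem_top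
    have hyb : (y : V') ∈ H₂.W (n - b) := H₂.monotone_W (show j ≤ n - b by omega) y.2
    have heq : Submodule.Quotient.mk (tensorWIncl H₁ H₂ n i j h (x ⊗ₜ[ℚ] y)) =
        tensorGrMap H₁ H₂ n b (n - b) (by omega)
          (Submodule.Quotient.mk ⟨(x : V), hxb⟩ ⊗ₜ[ℚ] Submodule.Quotient.mk ⟨(y : V'), hyb⟩) := by
      rw [tensorGrMap_mk_tmul_mk]
      exact congrArg _ (Subtype.ext rfl)
    rw [heq]
    exact Submodule.mem_iSup_of_mem b
      (Submodule.mem_iSup_of_mem (Finset.mem_Icc.2 ⟨by omega, le_rfl⟩) (LinearMap.mem_range_self _ _))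
  · -- `a ≤ i ≤ b`
    have hj : j = n - i := by omega
    subst hj
    rw [← tensorGrMap_mk_tmul_mk]
    exact Submodule.mem_iSup_of_mem i
      (Submodule.mem_iSup_of_mem (Finset.mem_Icc.2 ⟨by omega, by omega⟩) (LinearMap.mem_range_self _ _))

end Linear

/-! ### `tensorGrMap` is a morphism of Hodge structures -/

section Hodge

variable [FiniteDimensional ℚ V] [FiniteDimensional ℚ V']

/-- Comparison square behind the `F`-compatibility of `tensorGrMap`: for `ξ ∈ ℂ ⊗ W_i H₁`,
`η ∈ ℂ ⊗ W_j H₂`, `(tensorGrMap)_ℂ (π_i ξ ⊗ π_j η) = π_n ((tensorWIncl)_ℂ (ξ ⊗ η))`, the `π` being the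
projections `ℂ ⊗ W_k → ℂ ⊗ Gr^W_k` and `⊗` read through `tensorBaseChange`. [folklore] -/
private theorem baseChange_tensorGrMap_tmul_grProj {n i j : ℤ} (h : i + j = n) (ξ : ℂ ⊗[ℚ] ↥(H₁.W i))
    (η : ℂ ⊗[ℚ] ↥(H₂.W j)) :
    (tensorGrMap H₁ H₂ n i j h).baseChange ℂ
        ((tensorBaseChange (grW H₁.W i) (grW H₂.W j)).symm (grProj H₁.W i ξ ⊗ₜ[ℂ] grProj H₂.W j η)) =
      grProj (tensor H₁ H₂).W n
        ((tensorWIncl H₁ H₂ n i j h).baseChange ℂ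
          ((tensorBaseChange ↥(H₁.W i) ↥(H₂.W j)).symm (ξ ⊗ₜ[ℂ] η))) := by
  induction ξ using TensorProduct.induction_on with
  | zero => simp only [map_zero, TensorProduct.zero_tmul]
  | add ξ ξ' hξ hξ' => simp only [map_add, TensorProduct.add_tmul, hξ, hξ']
  | tmul c x =>
    induction η using TensorProduct.induction_on with
    | zero => simp only [map_zero, TensorProduct.tmul_zero]
    | add η η' hη hη' => simp only [map_add, TensorProduct.tmul_add, hη, hη']
    | tmul d y =>
      simp only [grProj, LinearMap.baseChange_tmul, Submodule.mkQ_apply, tensorBaseChange_symm_tmul_tmul,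
        tensorGrMap_mk_tmul_mk]

/-- Second comparison square: `ι_n ((tensorWIncl)_ℂ (ξ ⊗ η)) = ι_i ξ ⊗ ι_j η` in `ℂ ⊗ (V ⊗ V')`, the
`ι` being the inclusions `ℂ ⊗ W_k → ℂ ⊗ (ambient space)`. [folklore] -/
private theorem grIncl_tensorWIncl_baseChange {n i j : ℤ} (h : i + j = n) (ξ : ℂ ⊗[ℚ] ↥(H₁.W i))
    (η : ℂ ⊗[ℚ] ↥(H₂.W j)) :
    grIncl (tensor H₁ H₂).W n
        ((tensorWIncl H₁ H₂ n i j h).baseChange ℂ ((tensorBaseChange ↥(H₁.W i) ↥(H₂.W j)).symm (ξ ⊗ₜ[ℂ] η))) =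
      (tensorBaseChange V V').symm (grIncl H₁.W i ξ ⊗ₜ[ℂ] grIncl H₂.W j η) := by
  induction ξ using TensorProduct.induction_on with
  | zero => simp only [map_zero, TensorProduct.zero_tmul]
  | add ξ ξ' hξ hξ' => simp only [map_add, TensorProduct.add_tmul, hξ, hξ']
  | tmul c x =>
    induction η using TensorProduct.induction_on with
    | zero => simp only [map_zero, TensorProduct.tmul_zero]
    | add η η' hη hη' => simp only [map_add, TensorProduct.tmul_add, hη, hη']
    | tmul d y =>
      simp only [grIncl, LinearMap.baseChange_tmul, Submodule.subtype_apply, tensorBaseChange_symm_tmul_tmul,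
        coe_tensorWIncl_tmul]

variable [HodgeTensorFacts.{u, v}]

/-- **`Gr^W_i H₁ ⊗ Gr^W_j H₂ → Gr^W_n(H₁ ⊗ H₂)` is a morphism of Hodge structures** (`i + j = n`; the
source is the tensor product of the pure Hodge structures `Gr^W_i H₁`, `Gr^W_j H₂`, of weight `i + j`
transported to `n`): a generator `ξ ⊗ η` of `F^a Gr^W_i H₁ ⊗ F^b Gr^W_j H₂` (`p ≤ a + b`) lifts to
`ξ₀ ⊗ η₀` with `ξ₀ ∈ F^a H₁ ∩ W_{i,ℂ}`, `η₀ ∈ F^b H₂ ∩ W_{j,ℂ}`, and `ξ₀ ⊗ η₀ ∈ F^a ⊗ F^b ⊆ F^p(H₁ ⊗ H₂)`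
maps to the class of `(tensorGrMap)_ℂ (ξ ⊗ η)`, which therefore lies in the induced `F^p Gr^W_n(H₁ ⊗ H₂)`.
Deligne, Hodge II, 1.1.12 (the evident morphisms `⊗ Gr(A_i) → Gr(⊗ A_i)` of (bi)filtered objects).
[cite: DeligneHodgeII1971, 1.1.12] [cite: CattaniElZeinGriffithsLe2014, §3.2.2.7] -/
def tensorGrHom (n i j : ℤ) (h : i + j = n) :
    HodgeStructure.Hom (((H₁.gr i).tensor (H₂.gr j)).cast h) ((tensor H₁ H₂).gr n) where
  toLinearMap := tensorGrMap H₁ H₂ n i j h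
  map_F_le p := by
    rw [HodgeStructure.cast_F, HodgeStructure.tensor_F, HodgeStructure.tensorFiltration,
      Submodule.map_le_iff_le_comap]
    refine iSup_le fun a => iSup_le fun b => iSup_le fun hab => ?_
    intro z hz
    rw [Submodule.mem_comap] at hz
    obtain ⟨w, hw⟩ := hz
    rw [show z = (tensorBaseChange (grW H₁.W i) (grW H₂.W j)).symm (TensorProduct.mapIncl _ _ w) by
      rw [hw]; exact ((tensorBaseChange _ _).symm_apply_apply z).symm, Submodule.mem_comap]
    clear hw z
    induction w using TensorProduct.induction_on with
    | zero => rw [map_zero, map_zero, map_zero]; exact zero_mem _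
    | add w w' hw hw' => rw [map_add, map_add, map_add]; exact add_mem hw hw'
    | tmul ξ η =>
      obtain ⟨ξ, hξ⟩ := ξ
      obtain ⟨η, hη⟩ := η
      rw [gr_F, grF, Submodule.mem_map] at hξ hη
      obtain ⟨ξ₀, hξ₀, rfl⟩ := hξ
      obtain ⟨η₀, hη₀, rfl⟩ := hη
      rw [Submodule.mem_comap] at hξ₀ hη₀
      rw [TensorProduct.mapIncl, TensorProduct.map_tmul, Submodule.subtype_apply, Submodule.subtype_apply,
        baseChange_tensorGrMap_tmul_grProj, gr_F, grF]
      refine ⟨_, ?_, rfl⟩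
      rw [SetLike.mem_coe, Submodule.mem_comap, grIncl_tensorWIncl_baseChange, tensor_F]
      refine Submodule.mem_iSup_of_mem (a, p - a) (Submodule.mem_iSup_of_mem (show a + (p - a) = p by ring) ?_)
      rw [Submodule.mem_comap, LinearEquiv.coe_coe, LinearEquiv.apply_symm_apply]
      exact Submodule.apply_mem_map₂ _ hξ₀ (H₂.antitone_F (show p - a ≤ b by omega) hη₀)

/-- The underlying map of `tensorGrHom` is `tensorGrMap`. [cite: DeligneHodgeII1971, 1.1.12] -/
@[simp]
theorem tensorGrHom_toLinearMap {n i j : ℤ} (h : i + j = n) :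
    (tensorGrHom H₁ H₂ n i j h).toLinearMap = tensorGrMap H₁ H₂ n i j h :=
  rfl

/-! ### The direct sum `⊕_{i} Gr^W_i H₁ ⊗ Gr^W_{n-i} H₂ → Gr^W_n(H₁ ⊗ H₂)`: onto and injective -/

/-- The summands `Gr^W_i H₁ ⊗ Gr^W_{n-i} H₂` (`i ∈ s`), pure Hodge structures of weight `i + (n - i)`
transported to weight `n`. [cite: DeligneHodgeII1971, 1.1.12] -/
def tensorGrSummand (n : ℤ) (s : Finset ℤ) (i : ↥s) :
    HodgeStructure (grW H₁.W (i : ℤ) ⊗[ℚ] grW H₂.W (n - i)) n :=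
  ((H₁.gr i).tensor (H₂.gr (n - i))).cast (by omega)

/-- **The morphism `⊕_{i ∈ s} Gr^W_i H₁ ⊗ Gr^W_{n-i} H₂ → Gr^W_n(H₁ ⊗ H₂)`** of Hodge structures of
weight `n` defined by the family `tensorGrHom` (`Hom.piDesc` on the finite direct sum `HodgeStructure.pi`).
[cite: DeligneHodgeII1971, 1.1.12 and 2.1] -/
def tensorGrPiHom (n : ℤ) (s : Finset ℤ) :
    HodgeStructure.Hom (HodgeStructure.pi (tensorGrSummand H₁ H₂ n s)) ((tensor H₁ H₂).gr n) :=
  HodgeStructure.Hom.piDesc fun i : ↥s => tensorGrHom H₁ H₂ n i (n - i) (by omega)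

/-- On the summand `i`, `tensorGrPiHom` is `tensorGrMap n i (n - i)`. [cite: DeligneHodgeII1971, 1.1.12] -/
theorem tensorGrPiHom_toLinearMap_single (n : ℤ) (s : Finset ℤ) (i : ↥s)
    (u : grW H₁.W (i : ℤ) ⊗[ℚ] grW H₂.W (n - i)) :
    (tensorGrPiHom H₁ H₂ n s).toLinearMap (Pi.single i u) = tensorGrMap H₁ H₂ n i (n - i) (by omega) u := by
  rw [tensorGrPiHom, HodgeStructure.Hom.piDesc_single, tensorGrHom_toLinearMap]

/-- `⊕_{i ∈ s} Gr^W_i H₁ ⊗ Gr^W_{n-i} H₂ → Gr^W_n(H₁ ⊗ H₂)` is onto as soon as `s ⊇ [a, b]` with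
`W_{a-1} H₁ = 0`, `W_b H₁ = V` (`iSup_range_tensorGrMap_eq_top`, `Hom.range_piDesc`).
[cite: DeligneHodgeII1971, 1.1.12] -/
theorem range_tensorGrPiHom_eq_top (n : ℤ) {a b : ℤ} (ha : H₁.W (a - 1) = ⊥) (hb : H₁.W b = ⊤)
    (s : Finset ℤ) (hs : ∀ i, a ≤ i → i ≤ b → i ∈ s) :
    LinearMap.range (tensorGrPiHom H₁ H₂ n s).toLinearMap = ⊤ := by
  rw [tensorGrPiHom, HodgeStructure.Hom.range_piDesc, eq_top_iff, ← iSup_range_tensorGrMap_eq_top H₁ H₂ n ha hb]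
  refine iSup₂_le fun i hi => ?_
  rw [Finset.mem_Icc] at hi
  exact le_iSup_of_le ⟨i, hs i hi.1 hi.2⟩ le_rfl

end Hodge

section Injective

/-- A linear map `π : M → Gr^W_k` extending the projection `W_k → Gr^W_k` is that projection on `W_k`.
[folklore] -/
private theorem apply_eq_mk_of_comp_subtype_eq {M : Type*} [AddCommGroup M] [Module ℚ M]
    {W : ℤ → Submodule ℚ M} {k : ℤ} {π : M →ₗ[ℚ] grW W k}
    (hπ : π ∘ₗ (W k).subtype = (subPiece W k).mkQ) (v : W k) : π v = Submodule.Quotient.mk v := by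
  have h := LinearMap.congr_fun hπ v
  rwa [LinearMap.comp_apply, Submodule.subtype_apply, Submodule.mkQ_apply] at h

/-- … and it kills `W_{k'}` for `k' < k` (`W` increasing). [folklore] -/
private theorem apply_eq_zero_of_comp_subtype_eq {M : Type*} [AddCommGroup M] [Module ℚ M]
    {W : ℤ → Submodule ℚ M} (hW : Monotone W) {k k' : ℤ} {π : M →ₗ[ℚ] grW W k}
    (hπ : π ∘ₗ (W k).subtype = (subPiece W k).mkQ) (hk : k' + 1 ≤ k) {v : M} (hv : v ∈ W k') :
    π v = 0 := by
  rw [apply_eq_mk_of_comp_subtype_eq hπ ⟨v, hW (show k' ≤ k by omega) hv⟩, Submodule.Quotient.mk_eq_zero]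
  exact hW (show k' ≤ k - 1 by omega) hv

variable [FiniteDimensional ℚ V] [FiniteDimensional ℚ V']

/-- If `π : V → Gr^W_k H₁`, `π' : V' → Gr^W_l H₂` extend the projections `W → Gr^W` and `k + l = n`,
then `v ⊗ v' ↦ π v ⊗ π' v'` kills `W_{n-1}(H₁ ⊗ H₂) = Σ_{k'+l'=n-1} W_{k'} ⊗ W_{l'}`: for `x ∈ W_{k'}`,
`y ∈ W_{l'}`, `π x = 0` if `k > k'` and `π' y = 0` otherwise (`l > l'`). [folklore] -/
private theorem tensor_W_le_ker_map (n k l : ℤ) (hkl : k + l = n) {π : V →ₗ[ℚ] grW H₁.W k}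
    {π' : V' →ₗ[ℚ] grW H₂.W l} (hπ : π ∘ₗ (H₁.W k).subtype = (subPiece H₁.W k).mkQ)
    (hπ' : π' ∘ₗ (H₂.W l).subtype = (subPiece H₂.W l).mkQ) :
    (tensor H₁ H₂).W (n - 1) ≤ LinearMap.ker (TensorProduct.map π π') := by
  rw [tensor_W]
  refine iSup₂_le fun ij hij => Submodule.map₂_le.2 fun x hx y hy => ?_
  have hij' : ij.1 + ij.2 = n - 1 := hij
  rw [LinearMap.mem_ker, TensorProduct.mk_apply, TensorProduct.map_tmul]
  by_cases hik : ij.1 + 1 ≤ k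
  · rw [apply_eq_zero_of_comp_subtype_eq H₁.monotone_W hπ hik hx, TensorProduct.zero_tmul]
  · rw [apply_eq_zero_of_comp_subtype_eq H₂.monotone_W hπ' (show ij.2 + 1 ≤ l by omega) hy,
      TensorProduct.tmul_zero]

/-- The `(k, l)`-component `Gr^W_n(H₁ ⊗ H₂) → Gr^W_k H₁ ⊗ Gr^W_l H₂` (`k + l = n`) of the retraction:
`[w] ↦ (π ⊗ π') w`, well defined by `tensor_W_le_ker_map`. [folklore] -/
private def retractionComponent (n k l : ℤ) (hkl : k + l = n) {π : V →ₗ[ℚ] grW H₁.W k}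
    {π' : V' →ₗ[ℚ] grW H₂.W l} (hπ : π ∘ₗ (H₁.W k).subtype = (subPiece H₁.W k).mkQ)
    (hπ' : π' ∘ₗ (H₂.W l).subtype = (subPiece H₂.W l).mkQ) :
    grW (tensor H₁ H₂).W n →ₗ[ℚ] grW H₁.W k ⊗[ℚ] grW H₂.W l :=
  (subPiece (tensor H₁ H₂).W n).liftQ (TensorProduct.map π π' ∘ₗ ((tensor H₁ H₂).W n).subtype)
    fun w hw => by
      rw [subPiece, Submodule.submoduleOf, Submodule.mem_comap] at hw
      rw [LinearMap.mem_ker, LinearMap.comp_apply, Submodule.subtype_apply]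
      exact (LinearMap.mem_ker).1 (tensor_W_le_ker_map H₁ H₂ n k l hkl hπ hπ' hw)

/-- `retractionComponent [x ⊗ y] = π x ⊗ π' y`. [folklore] -/
private theorem retractionComponent_mk_tensorWIncl (n k l : ℤ) (hkl : k + l = n) {π : V →ₗ[ℚ] grW H₁.W k}
    {π' : V' →ₗ[ℚ] grW H₂.W l} (hπ : π ∘ₗ (H₁.W k).subtype = (subPiece H₁.W k).mkQ)
    (hπ' : π' ∘ₗ (H₂.W l).subtype = (subPiece H₂.W l).mkQ) {i j : ℤ} (h : i + j = n) (x : H₁.W i)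
    (y : H₂.W j) :
    retractionComponent H₁ H₂ n k l hkl hπ hπ' (Submodule.Quotient.mk (tensorWIncl H₁ H₂ n i j h (x ⊗ₜ[ℚ] y))) =
      π x ⊗ₜ[ℚ] π' y := by
  rw [retractionComponent, Submodule.liftQ_apply, LinearMap.comp_apply, Submodule.subtype_apply,
    coe_tensorWIncl_tmul, TensorProduct.map_tmul]

/-- The retraction `L : Gr^W_n(H₁ ⊗ H₂) → ⊕_{i ∈ s} Gr^W_i H₁ ⊗ Gr^W_{n-i} H₂`, `[v ⊗ v'] ↦ (π_i v ⊗ π'_{n-i} v')_i`,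
for families `π_k : V → Gr^W_k H₁`, `π'_l : V' → Gr^W_l H₂` extending the projections. [folklore] -/
private def retraction (n : ℤ) (s : Finset ℤ) {π : ∀ k : ℤ, V →ₗ[ℚ] grW H₁.W k}
    {π' : ∀ k : ℤ, V' →ₗ[ℚ] grW H₂.W k} (hπ : ∀ k, π k ∘ₗ (H₁.W k).subtype = (subPiece H₁.W k).mkQ)
    (hπ' : ∀ k, π' k ∘ₗ (H₂.W k).subtype = (subPiece H₂.W k).mkQ) :
    grW (tensor H₁ H₂).W n →ₗ[ℚ] (∀ i : ↥s, grW H₁.W (i : ℤ) ⊗[ℚ] grW H₂.W (n - i)) :=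
  LinearMap.pi fun i : ↥s => retractionComponent H₁ H₂ n i (n - i) (by omega) (hπ i) (hπ' (n - i))

/-- `L [x ⊗ y] = (π_i x ⊗ π'_{n-i} y)_i`. [folklore] -/
private theorem retraction_mk_tensorWIncl (n : ℤ) (s : Finset ℤ) {π : ∀ k : ℤ, V →ₗ[ℚ] grW H₁.W k}
    {π' : ∀ k : ℤ, V' →ₗ[ℚ] grW H₂.W k} (hπ : ∀ k, π k ∘ₗ (H₁.W k).subtype = (subPiece H₁.W k).mkQ)
    (hπ' : ∀ k, π' k ∘ₗ (H₂.W k).subtype = (subPiece H₂.W k).mkQ) {i j : ℤ} (h : i + j = n) (x : H₁.W i)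
    (y : H₂.W j) (i' : ↥s) :
    retraction H₁ H₂ n s hπ hπ' (Submodule.Quotient.mk (tensorWIncl H₁ H₂ n i j h (x ⊗ₜ[ℚ] y))) i' =
      π i' x ⊗ₜ[ℚ] π' (n - i') y := by
  rw [retraction, LinearMap.pi_apply, retractionComponent_mk_tensorWIncl]

variable [HodgeTensorFacts.{u, v}]

/-- **`⊕_{i ∈ s} Gr^W_i H₁ ⊗ Gr^W_{n-i} H₂ → Gr^W_n(H₁ ⊗ H₂)` is injective** (for any finite set `s` of
first indices) — the injectivity half of Deligne's «ce sont des isomorphismes» (Hodge II, 1.1.12).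
Proof: choose linear extensions `π_k : V → Gr^W_k H₁`, `π'_l : V' → Gr^W_l H₂` of the projections
`W_k → Gr^W_k` (they exist over a field); `π_k` kills `W_{k-1}`.  The map
`v ⊗ v' ↦ (π_i v ⊗ π'_{n-i} v')_i` kills `W_{n-1}(H₁ ⊗ H₂) = Σ_{k+l=n-1} W_k ⊗ W_l` (for `x ∈ W_k`,
`y ∈ W_l`: `π_i x = 0` if `i > k`, `π'_{n-i} y = 0` if `i ≤ k`), so descends to
`L : Gr^W_n(H₁ ⊗ H₂) → ⊕_i Gr^W_i H₁ ⊗ Gr^W_{n-i} H₂`, and `L [x ⊗ y] = ([x] ⊗ [y])` placed in degree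
`i` for `x ∈ W_i`, `y ∈ W_{n-i}`: `L` is a retraction of the direct-sum map. [cite: DeligneHodgeII1971, 1.1.12] -/
theorem tensorGrPiHom_injective (n : ℤ) (s : Finset ℤ) :
    Function.Injective (tensorGrPiHom H₁ H₂ n s).toLinearMap := by
  -- linear extensions of the projections `W_k → Gr^W_k`
  have hex₁ : ∀ k : ℤ, ∃ π : V →ₗ[ℚ] grW H₁.W k, π ∘ₗ (H₁.W k).subtype = (subPiece H₁.W k).mkQ :=
    fun k => LinearMap.exists_extend _
  have hex₂ : ∀ k : ℤ, ∃ π : V' →ₗ[ℚ] grW H₂.W k, π ∘ₗ (H₂.W k).subtype = (subPiece H₂.W k).mkQ :=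
    fun k => LinearMap.exists_extend _
  choose π hπ using hex₁
  choose π' hπ' using hex₂
  -- `L ∘ Φ = id`
  have hLΦ : retraction H₁ H₂ n s hπ hπ' ∘ₗ (tensorGrPiHom H₁ H₂ n s).toLinearMap = LinearMap.id := by
    refine LinearMap.pi_ext fun i u => ?_
    rw [LinearMap.comp_apply, LinearMap.id_apply, tensorGrPiHom_toLinearMap_single]
    induction u using TensorProduct.induction_on with
    | zero => rw [map_zero, map_zero, Pi.single_zero]
    | add u u' hu hu' => rw [map_add, map_add, hu, hu', Pi.single_add]
    | tmul x y =>
      induction x using Submodule.Quotient.induction_on with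
      | _ x =>
        induction y using Submodule.Quotient.induction_on with
        | _ y =>
          rw [tensorGrMap_mk_tmul_mk]
          funext i'
          rw [retraction_mk_tensorWIncl]
          by_cases hi' : i' = i
          · subst hi'
            rw [Pi.single_eq_same, apply_eq_mk_of_comp_subtype_eq (hπ i') x,
              apply_eq_mk_of_comp_subtype_eq (hπ' (n - i')) y]
          · rw [Pi.single_eq_of_ne hi']
            have hne : (i' : ℤ) ≠ i := fun h => hi' (Subtype.ext h)
            rcases lt_or_gt_of_ne hne with hlt | hgt
            · rw [apply_eq_zero_of_comp_subtype_eq H₂.monotone_W (hπ' (n - i'))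
                  (show (n - i) + 1 ≤ n - i' by omega) y.2, TensorProduct.tmul_zero]
            · rw [apply_eq_zero_of_comp_subtype_eq H₁.monotone_W (hπ i') (show (i : ℤ) + 1 ≤ i' by omega) x.2,
                TensorProduct.zero_tmul]
  intro u u' huu'
  have hu := LinearMap.congr_fun hLΦ u
  have hu' := LinearMap.congr_fun hLΦ u'
  rw [LinearMap.comp_apply, LinearMap.id_apply] at hu hu'
  rw [← hu, ← hu', huu']

/-- **`⊕_{a ≤ i ≤ b} Gr^W_i H₁ ⊗ Gr^W_{n-i} H₂ ≅ Gr^W_n(H₁ ⊗ H₂)`**: for `s ⊇ [a, b]` with `W_{a-1} H₁ = 0`,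
`W_b H₁ = V`, the morphism of Hodge structures `tensorGrPiHom H₁ H₂ n s` is bijective (so an isomorphism of
Hodge structures, with inverse `HodgeStructure.Hom.inverse`) — Deligne, Hodge II, 1.1.12: the evident
morphisms `⊗ Gr(A_i) → Gr(⊗ A_i)` «sont des isomorphismes» for an exact `⊗`. [cite: DeligneHodgeII1971, 1.1.12] -/
theorem tensorGrPiHom_bijective (n : ℤ) {a b : ℤ} (ha : H₁.W (a - 1) = ⊥) (hb : H₁.W b = ⊤)
    (s : Finset ℤ) (hs : ∀ i, a ≤ i → i ≤ b → i ∈ s) :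
    Function.Bijective (tensorGrPiHom H₁ H₂ n s).toLinearMap :=
  ⟨tensorGrPiHom_injective H₁ H₂ n s,
    LinearMap.range_eq_top.1 (range_tensorGrPiHom_eq_top H₁ H₂ n ha hb s hs)⟩

omit [HodgeTensorFacts.{u, v}] in
/-- **Each `Gr^W_i H₁ ⊗ Gr^W_j H₂ → Gr^W_{i+j}(H₁ ⊗ H₂)` is injective.** [cite: DeligneHodgeII1971, 1.1.12] -/
theorem tensorGrMap_injective (n i j : ℤ) (h : i + j = n) : Function.Injective (tensorGrMap H₁ H₂ n i j h) := by
  haveI : HodgeTensorFacts.{u, v} := hodgeTensorFacts_holds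
  have hj : j = n - i := by omega
  subst hj
  intro u u' huu'
  have h1 : (tensorGrPiHom H₁ H₂ n {i}).toLinearMap (Pi.single ⟨i, Finset.mem_singleton_self i⟩ u) =
      (tensorGrPiHom H₁ H₂ n {i}).toLinearMap (Pi.single ⟨i, Finset.mem_singleton_self i⟩ u') := by
    rw [tensorGrPiHom_toLinearMap_single, tensorGrPiHom_toLinearMap_single]
    exact huu'
  exact (Pi.single_inj (M := fun i' : ↥({i} : Finset ℤ) => grW H₁.W (i' : ℤ) ⊗[ℚ] grW H₂.W (n - i'))
    ⟨i, Finset.mem_singleton_self i⟩).1 (tensorGrPiHom_injective H₁ H₂ n {i} h1)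

end Injective

/-! ### `H₁ ⊗ H₂` is graded-polarizable -/

section Polarizable

variable {X : Type u} [AddCommGroup X] [Module ℚ X] {X' : Type u} [AddCommGroup X'] [Module ℚ X']

/-- A quotient of a finite-dimensional polarizable Hodge structure is polarizable: a surjective
morphism `G₁ → G₂` from a polarizable `G₁` has a section which is a morphism of Hodge structures
(`Hom.exists_section_of_surjective`), injective, along which the polarization pulls back
(`Polarization.comap`).  (The tree's `HodgeStructure.IsPolarizable.of_hom_surjective`,
`Geometry/Kaehler/ComplexTorusHodgeStructurePolarization.lean`, re-derived here in eight lines to keep the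
complex-torus theory out of the import cone of `Motives/`.) [cite: DeligneHodgeII1971, 2.1.15] -/
private theorem isPolarizable_of_hom_surjective {M : Type u} [AddCommGroup M] [Module ℚ M]
    [Module.Finite ℚ M] {M' : Type u} [AddCommGroup M'] [Module ℚ M'] {n : ℤ} {G₁ : HodgeStructure M n}
    {G₂ : HodgeStructure M' n} (hG₁ : G₁.IsPolarizable) (f : HodgeStructure.Hom G₁ G₂)
    (hf : Function.Surjective f.toLinearMap) : G₂.IsPolarizable := by
  obtain ⟨σ, hσ⟩ := f.exists_section_of_surjective hG₁ hf
  have hinj : Function.Injective σ.toLinearMap := by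
    intro x y hxy
    have hx := LinearMap.congr_fun (congrArg HodgeStructure.Hom.toLinearMap hσ) x
    have hy := LinearMap.congr_fun (congrArg HodgeStructure.Hom.toLinearMap hσ) y
    simp only [HodgeStructure.Hom.comp, HodgeStructure.Hom.id, LinearMap.comp_apply, LinearMap.id_apply]
      at hx hy
    rw [← hx, ← hy, hxy]
  exact ⟨hG₁.some.comap σ hinj⟩

variable [FiniteDimensional ℚ X] [FiniteDimensional ℚ X']
variable (K₁ : MixedHodgeStructure X) (K₂ : MixedHodgeStructure X')

/-- **`Gr^W_n(H₁ ⊗ H₂)` is polarizable when `H₁`, `H₂` are graded-polarizable** (one universe, as for the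
tree's `HodgeStructure.IsPolarizable.tensor`): it is a quotient of the polarizable Hodge structure
`⊕_{a ≤ i ≤ b} Gr^W_i H₁ ⊗ Gr^W_{n-i} H₂` (`IsPolarizable.pi`, `IsPolarizable.tensor`: `HS^pol_ℚ` is closed
under direct sums and tensor products, Moonen §2.1) by the surjective morphism `tensorGrPiHom`
(Deligne 1.1.12), and quotients of polarizable Hodge structures are polarizable (Deligne 2.1.15).
[cite: DeligneHodgeII1971, 1.1.12 and 2.1.15] [cite: Moonen2017FamiliesMotives, §2.1 (p. 3)] -/
theorem isPolarizable_gr_tensor (h₁ : K₁.IsGradedPolarizable) (h₂ : K₂.IsGradedPolarizable) (n : ℤ) :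
    ((tensor K₁ K₂).gr n).IsPolarizable := by
  haveI : HodgeTensorFacts.{u, u} := hodgeTensorFacts_holds
  obtain ⟨a₀, ha₀⟩ := K₁.exists_W_eq_bot
  obtain ⟨b, hb⟩ := K₁.exists_W_eq_top
  have ha : K₁.W (a₀ + 1 - 1) = ⊥ := by rw [add_sub_cancel_right, ha₀]
  have hpi : (HodgeStructure.pi (tensorGrSummand K₁ K₂ n (Finset.Icc (a₀ + 1) b))).IsPolarizable :=
    HodgeStructure.IsPolarizable.pi fun i => ((h₁ i).tensor (h₂ (n - i))).cast _
  exact isPolarizable_of_hom_surjective hpi (tensorGrPiHom K₁ K₂ n _)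
    (LinearMap.range_eq_top.1
      (range_tensorGrPiHom_eq_top K₁ K₂ n ha hb _ fun i hai hib => Finset.mem_Icc.2 ⟨hai, hib⟩))

/-- **The tensor product of graded-polarizable mixed Hodge structures is graded-polarizable**
(every `Gr^W_n(H₁ ⊗ H₂)` is polarizable, `isPolarizable_gr_tensor`). [cite: DeligneHodgeII1971, 1.1.12 and 2.1.15]
[cite: Moonen2017FamiliesMotives, §2.1 (p. 3)] [cite: Carlson1980, §2(a)] -/
theorem IsGradedPolarizable.tensor {K₁ : MixedHodgeStructure X} {K₂ : MixedHodgeStructure X'}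
    (h₁ : K₁.IsGradedPolarizable) (h₂ : K₂.IsGradedPolarizable) : (tensor K₁ K₂).IsGradedPolarizable :=
  fun n => isPolarizable_gr_tensor K₁ K₂ h₁ h₂ n

end Polarizable

end MixedHodgeStructure

end Literature.AlgebraicGeometry.Motives

end
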